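import Literature.Topology.FourManifolds.ThreeTorusOrientation
import Literature.AlgebraicTopology.SingularHomology.FundamentalClassExistence
import HarnessLib

/-!
# Discharge of the puncture comparison for `T³` and the Cappell–Shaneson target fact from the
two remaining named facts

Sibling proof file of `CappellShanesonWang.lean` (S. E. Cappell, J. L. Shaneson, *Some new
four-manifolds*, Ann. of Math. 104 (1976), §2: for `A ∈ SL(3, ℤ)` with `det(A - 1) = ±1`, surgery
on the section circle of the mapping torus of `A` on `T³` is a homotopy 4-sphere).

`CappellShanesonWang.lean` vendored two torus inputs as named facts; the second one,
`Literature.Topology.FourManifolds.isIso_singularHomology_map_puncturedThreeTorusIncl` (`T³ ∖ {1} ↪ T³` is an isomorphism on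
`H₁`, `H₂` with `ℤ`-coefficients; Hatcher Thm. 2.20 with §3.3 Thm. 3.26), was reduced in
`PuncturedThreeTorusHomology.lean` and `ThreeTorusOrientation.lean` to the existence of fundamental
classes for the (now provably `ℤ`-orientable) closed 3-manifold `T³`.  That existence statement is
a theorem of the tree (`Literature.AlgebraicTopology.SingularHomology.existsUnique_isFundamentalClass_holds`,
`…SingularHomology.FundamentalClassExistence`, Hatcher Thm. 3.26(a) / Lemma 3.27), so we record,
unconditionally:

* `Literature.Topology.FourManifolds.isIso_toLocal_threeTorus` — `H₃(T³; ℤ) → H₃(T³ | x; ℤ)` is an isomorphism for every `x`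
  (Hatcher Thm. 3.26(a) for `T³`);
* **`Literature.Topology.FourManifolds.isIso_singularHomology_map_puncturedThreeTorusIncl_holds`** — the discharge of the named
  fact of `CappellShanesonWang.lean`;
* **`Literature.Topology.FourManifolds.nonempty_homotopyEquiv_sphere_four_of_isCappellShanesonSphere_of_torusFacts'''`** —
  the Cappell–Shaneson target fact `…_of_isCappellShanesonSphere`, in every universe, from exactly
  two named facts: (T1) `Literature.Topology.FourManifolds.singularHomology_threeTorus_linear` (`H₁`, `H₂` of `T³` with the
  `SL(3, ℤ)`-action, Hatcher §3.C Ex. 11) and (W) `Literature.Topology.FourManifolds.nonempty_homotopyEquiv_sphere_four_iff`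
  at universe `0` (recognition of homotopy 4-spheres, `spc4.S10`).

Everything here is proved; nothing is asserted and no new data are introduced.

## References

* S. E. Cappell, J. L. Shaneson, *Some new four-manifolds*, Ann. of Math. 104 (1976), 61–72, §2
  [CappellShanesonAnnals1976].
* A. Hatcher, *Algebraic Topology*, CUP 2002, Thm. 2.20; §3.3 Thm. 3.26, Lemma 3.27; §3.C Ex. 11
  [HatcherAT2002].
-/

noncomputable section

namespace Literature.Topology.FourManifolds

universe u

/-- **`H₃(T³; ℤ) → H₃(T³ | x; ℤ)` is an isomorphism for every `x`** (Hatcher Thm. 3.26(a) for the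
closed connected orientable 3-manifold `T³`), unconditionally: orientability is
`isOrientableOver_int_threeTorus_holds`, existence of the fundamental class is
`existsUnique_isFundamentalClass_holds`. [cite: HatcherAT2002, §3.3 Thm. 3.26(a)] -/
theorem isIso_toLocal_threeTorus (x : ThreeTorus) :
    CategoryTheory.IsIso (Literature.AlgebraicTopology.SingularHomology.singularHomology.toLocal ℤ ℤ x 3) :=
  isIso_toLocal_threeTorus_of_isOrientable isOrientableOver_int_threeTorus_holds
    (Literature.AlgebraicTopology.SingularHomology.existsUnique_isFundamentalClass_holds (R := ℤ) (X := ThreeTorus) 3) x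

/-- **Discharge of the named fact `Literature.Topology.FourManifolds.isIso_singularHomology_map_puncturedThreeTorusIncl`**
(`CappellShanesonWang.lean`; Hatcher Thm. 2.20, §3.3 Thm. 3.26): `T³ ∖ {1} ↪ T³` induces
isomorphisms on `H₁` and `H₂` with integer coefficients — the orientability of `T³` and the
existence of fundamental classes being theorems of the tree. [cite: HatcherAT2002, §3.3 Thm. 3.26] -/
theorem isIso_singularHomology_map_puncturedThreeTorusIncl_holds :
    isIso_singularHomology_map_puncturedThreeTorusIncl :=
  isIso_singularHomology_map_puncturedThreeTorusIncl_of_existsFundamentalClass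
    (Literature.AlgebraicTopology.SingularHomology.existsUnique_isFundamentalClass_holds (R := ℤ) (X := ThreeTorus) 3)

section SPC4

/-- **Cappell–Shaneson spheres are homotopy 4-spheres, from the two remaining named facts**
(every universe): the target fact `nonempty_homotopyEquiv_sphere_four_of_isCappellShanesonSphere`
(Cappell–Shaneson, Ann. of Math. 104 (1976), §2) follows from (T1) the homology of `T³` with its
`SL(3, ℤ)`-action (`singularHomology_threeTorus_linear`, Hatcher §3.C Ex. 11) and (W) the
recognition of homotopy 4-spheres at universe `0` (`nonempty_homotopyEquiv_sphere_four_iff`,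
`spc4.S10`); the fundamental group, excision, Mayer–Vietoris exactness, the homology of spheres,
the local homology, orientation and fundamental class of `T³` are theorems of the tree.
[cite: CappellShanesonAnnals1976, §2] -/
theorem nonempty_homotopyEquiv_sphere_four_of_isCappellShanesonSphere_of_torusFacts'''
    (hT1 : singularHomology_threeTorus_linear)
    (hW : nonempty_homotopyEquiv_sphere_four_iff.{0})
    (X : Type u) [TopologicalSpace X] [ChartedSpace (EuclideanSpace ℝ (Fin 4)) X] :
    nonempty_homotopyEquiv_sphere_four_of_isCappellShanesonSphere X :=
  nonempty_homotopyEquiv_sphere_four_of_isCappellShanesonSphere_of_torusFacts'' hT1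
    (Literature.AlgebraicTopology.SingularHomology.existsUnique_isFundamentalClass_holds (R := ℤ) (X := ThreeTorus) 3) hW X

end SPC4

end Literature.Topology.FourManifolds
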